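import Summits.BirchSwinnertonDyer.BirchSwinnertonDyer.Theorems.ThetaPartnerAtTwoSignedControlAtTwoSignedEulerCharCount
import Literature.NumberTheory.EllipticCurves.IwasawaNoFiniteSubmoduleProofs
import HarnessLib

/-!
# COINV⁺@2 for Kobayashi's `Sel^ε(E/K_∞)`: Greenberg's chase («DIV» ∧ «LIFT» ⇒ `(Sel^ε_∞)_γ = 0`) and the
# equivalence COINV ⟺ «`X^ε` has no nonzero finite `Λ`-submodule» (B. D. Kim 2013 Thm. 1.1's shape)

Route `ThetaPartnerAtTwo` (TP2), crux K4 `SignedControlAtTwo` (stmt-BirchSwinnertonDyer-20309), line `eulerchar` v3: stub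
`stub_plusCoinvTwo` (COINV⁺@2: `Sel_{2^∞}(E/ℚ)` finite ⇒ `(Sel⁺_∞)_γ` finite ⇒ `#(Sel⁺_∞)_γ = 1`). This file gives the
stub its two printed readings, in the kernel, for Kobayashi's signed Selmer groups (the `±` twin of the ♭ road's
`…SupersingularFlatCoinvChase`, `bsd-2adic-ss-1` GEN 11; credit for the template):
* §1 (any number field `K`, `ℤ_p`-extension `κ`, sign `ε`, `γ ∈ Γ_K`) `signedEndCoinvariants_subsingleton_of_div_of_lift` —
  Greenberg's chase (LNM 1716, proof of Lemma 4.7 / Prop. 4.8, `Sel ↦ Sel^ε`): «DIV» (every `s ∈ Sel^ε_∞` is `conj_γ t − t` for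
  some `t ∈ H¹(K_∞, E[p^∞])`) ∧ «LIFT» (every `t` with `conj_γ t − t ∈ Sel^ε_∞` is congruent mod `Sel^ε_∞` to a restricted class
  `h_0 y`) ⇒ `(Sel^ε_∞)_γ = 0`. In print «DIV» is `H¹(K_Σ/K_∞, E[p^∞])_Γ = 0` (Prop. 4.12 + the corank count) and «LIFT» is
  Cassels' theorem + the local `Γ`-surjectivities at `Σ₀`, at `p` (the `±` local theory: `(E^±_∞ ⊗ ℚ_p/ℤ_p)_Γ = 0`) and at `∞`.
* §2 (any `K`, `κ`, `ε`, topological generator `γ`, Pontryagin-dual datum `D : SignedSelmerDualData W κ γ ε`)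
  `natCard_signedEndCoinvariants_eq_one_iff_forall_finite_eq_bot` — **COINV ⟺ `X^ε(E/K_∞)` has no nonzero finite
  `Λ`-submodule** (Greenberg p. 104 «easy exercise»; the statement of B. D. Kim, J. Aust. Math. Soc. 95 (2013) Thm. 1.1 /
  Thm. 3.14 for `Sel^±` at odd `p`), via Pontryagin duality `X[T] ≅ Hom(S_γ, ℚ/ℤ)` (tree `IsDualPair.exists_invariants_addEquiv`).
* §3 (`p = 2`, the habitat prefix dropped — any elliptic `W/ℚ`, any `κ`, `γ`): `plusCoinvTwo_of_forall_noFiniteSubmodule` — the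
  registered stub's body ⟸ «for one (equivalently every) Pontryagin-dual datum, `X⁺` has no nonzero finite `Λ₂`-submodule»;
  `plusCoinvTwo_of_div_of_lift` — ⟸ «DIV» ∧ «LIFT».
Seat `prover-bsd-wall-tp2-p3` (lead, LINE mode). HONEST FRAMING: THEOREMS ONLY (no definition, no named fact, no `sorry`),
route-independent; nothing about any curve is asserted beyond the displayed hypotheses; closes no item; BSD is not proved by any of this.

References: [GreenbergLNM1716] §1 p. 60, §4 p. 104, Lemma 4.7, Prop. 4.8 (pp. 107–109), Prop. 4.12; [BDKim2013] Thm. 1.1, Thm. 3.14;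
[KitajimaOtsuki2018] Thm. 1.3; [Kobayashi2003] Def. 1.1.
-/

set_option autoImplicit false
-- the Theorems namespace of this sub repeats the summit name by design (D-0017 nested layout)
set_option linter.dupNamespace false

noncomputable section

open scoped Classical NumberField

open NumberField IsDedekindDomain

universe u

namespace Summit.BirchSwinnertonDyer.BirchSwinnertonDyer.Theorems.SignedEC

open Literature.NumberTheory.EllipticCurves Literature.NumberTheory.GaloisRepresentations
  WeierstrassCurve ZpExtension Literature.NumberTheory.EllipticCurves.Kobayashi2003
  Literature.NumberTheory.EllipticCurves.IwasawaDual Literature.NumberTheory.EllipticCurves.IwasawaAlgebra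

/-! ## §1 The chase for `Sel^ε(E/K_∞)` -/

section Chase

variable {K : Type u} [Field K] [NumberField K] (W : WeierstrassCurve K) {p : ℕ} [Fact p.Prime]
  (κ : ZpExtension K p) (ε : ℤˣ) (γ : Field.absoluteGaloisGroup K)

/-- **Greenberg's chase (LNM 1716, proof of Lemma 4.7 / Prop. 4.8) for Kobayashi's `Sel^ε(E/K_∞)`: «DIV» ∧ «LIFT» ⇒
`(Sel^ε(E/K_∞))_γ = 0`.** If every `s ∈ Sel^ε_∞` is `conj_γ t − t` for some `t ∈ H¹(K_∞, E[p^∞])` («DIV») and every `t`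
with `conj_γ t − t ∈ Sel^ε_∞` is congruent modulo `Sel^ε_∞` to some `h_0 y`, `y ∈ H¹(K, E[p^∞])` («LIFT»), then the
`γ`-coinvariants of `Sel^ε_∞` vanish: `t' = t − h_0 y ∈ Sel^ε_∞` has `conj_γ t' − t' = s` (`h_0 y` is `Γ_K`-invariant).
[cite: GreenbergLNM1716, §4 Lemma 4.7 (pp. 107–108) and Prop. 4.8 (p. 109)] [cite: BDKim2013, Thm. 3.14] -/
theorem signedEndCoinvariants_subsingleton_of_div_of_lift
    (hdiv : ∀ s : W.subgroupH1 p κ.kerSubgroup, s ∈ signedSelmerInfty W κ ε →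
      ∃ t : W.subgroupH1 p κ.kerSubgroup, W.conjH1 p κ.kerSubgroup γ t - t = s)
    (hlift : ∀ t : W.subgroupH1 p κ.kerSubgroup, W.conjH1 p κ.kerSubgroup γ t - t ∈ signedSelmerInfty W κ ε →
      ∃ y : W.subgroupH1 p (κ.layerSubgroup 0), t - W.layerToInfty κ 0 y ∈ signedSelmerInfty W κ ε) :
    Subsingleton (EndCoinvariants (conjSignedSelmerInfty W κ ε γ - 1)) := by
  refine subsingleton_of_forall_eq 0 fun q ↦ ?_
  induction q using QuotientAddGroup.induction_on with
  | H s =>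
    obtain ⟨t, ht⟩ := hdiv s s.2
    have htS : W.conjH1 p κ.kerSubgroup γ t - t ∈ signedSelmerInfty W κ ε := by
      rw [ht]; exact s.2
    obtain ⟨y, hy⟩ := hlift t htS
    have hinv : W.conjH1 p κ.kerSubgroup γ (W.layerToInfty κ 0 y) = W.layerToInfty κ 0 y := by
      have hmem := W.range_layerToInfty_le_layerInvariants_holds κ 0 ⟨y, rfl⟩
      rw [W.mem_layerInvariants_iff κ 0] at hmem
      exact hmem γ (by rw [ZpExtension.layerSubgroup_zero]; trivial)
    refine (endCoinvariants_mk_eq_zero_iff _ s).mpr ⟨⟨t - W.layerToInfty κ 0 y, hy⟩, ?_⟩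
    apply Subtype.ext
    rw [End_sub_apply, AddMonoid.End.one_apply, AddSubgroupClass.coe_sub, coe_conjSignedSelmerInfty_apply]
    change W.conjH1 p κ.kerSubgroup γ (t - W.layerToInfty κ 0 y) - (t - W.layerToInfty κ 0 y) = (s : _)
    rw [map_sub, hinv, ← ht]
    abel

/-- **«DIV» ∧ «LIFT» ⇒ `#(Sel^ε(E/K_∞))_γ = 1`** (`Nat.card` form of the chase).
[cite: GreenbergLNM1716, §4 Prop. 4.8 (p. 109)] -/
theorem natCard_signedEndCoinvariants_eq_one_of_div_of_lift
    (hdiv : ∀ s : W.subgroupH1 p κ.kerSubgroup, s ∈ signedSelmerInfty W κ ε →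
      ∃ t : W.subgroupH1 p κ.kerSubgroup, W.conjH1 p κ.kerSubgroup γ t - t = s)
    (hlift : ∀ t : W.subgroupH1 p κ.kerSubgroup, W.conjH1 p κ.kerSubgroup γ t - t ∈ signedSelmerInfty W κ ε →
      ∃ y : W.subgroupH1 p (κ.layerSubgroup 0), t - W.layerToInfty κ 0 y ∈ signedSelmerInfty W κ ε) :
    Nat.card (EndCoinvariants (conjSignedSelmerInfty W κ ε γ - 1)) = 1 := by
  haveI := signedEndCoinvariants_subsingleton_of_div_of_lift W κ ε γ hdiv hlift
  exact Nat.card_unique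

end Chase

/-! ## §2 COINV ⟺ `X^ε` has no nonzero finite `Λ`-submodule (Greenberg's «easy exercise», p. 104) -/

section NoFiniteSubmodule

variable {K : Type u} [Field K] [NumberField K] {W : WeierstrassCurve K} {p : ℕ} [Fact p.Prime]
  {κ : ZpExtension K p} {ε : ℤˣ} {γ : Field.absoluteGaloisGroup K}

/-- **`(Sel^ε_∞)_γ = 0 ⇒ X^ε[T] = 0`** for every Pontryagin-dual datum `D` of Kobayashi's `Sel^ε(E/K_∞)` and a topological
generator `γ` (`T = γ − 1`): Pontryagin duality `X[T] ≅ Hom(S_γ, ℚ/ℤ)` (tree `IsDualPair.exists_invariants_addEquiv`).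
[cite: GreenbergLNM1716, §1 p. 60 and §4 p. 104] -/
theorem signed_invariants_eq_bot_of_endCoinvariants_subsingleton (D : SignedSelmerDualData W κ γ ε)
    (hγ : κ.IsTopGenerator γ) [Subsingleton (EndCoinvariants (conjSignedSelmerInfty W κ ε γ - 1))] :
    invariants p D.X = ⊥ := by
  obtain ⟨Φ, -⟩ := (D.isDualPair hγ).exists_invariants_addEquiv
  haveI : Subsingleton (CharacterModule (EndCoinvariants (conjSignedSelmerInfty W κ ε γ - 1))) :=
    PontryaginCard.subsingleton_characterModule
  rw [Submodule.eq_bot_iff]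
  intro x hx
  have h0 : (⟨x, hx⟩ : invariants p D.X) = 0 := Φ.injective (Subsingleton.elim _ _)
  exact congrArg Subtype.val h0

/-- **COINV ⇒ `X^ε(E/K_∞)` has no nonzero finite `Λ`-submodule** (Greenberg p. 104; the statement of B. D. Kim 2013 Thm. 1.1
/ Kitajima–Otsuki 2018 Thm. 1.3 for `Sel^±` at odd `p`): a nonzero finite submodule would meet `X[T]` non-trivially
(`forall_finite_eq_bot_of_forall_pow_smul_invariants_eq_zero`), but `X[T] = 0`.
[cite: GreenbergLNM1716, §4 p. 104 and Prop. 4.8 (p. 109)] [cite: BDKim2013, Thm. 1.1] -/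
theorem signed_forall_finite_eq_bot_of_endCoinvariants_subsingleton (D : SignedSelmerDualData W κ γ ε)
    (hγ : κ.IsTopGenerator γ) [Subsingleton (EndCoinvariants (conjSignedSelmerInfty W κ ε γ - 1))] :
    ∀ N : Submodule (IwasawaAlgebra p) D.X, Finite N → N = ⊥ := by
  refine forall_finite_eq_bot_of_forall_pow_smul_invariants_eq_zero p fun x hx _ _ ↦ ?_
  rw [signed_invariants_eq_bot_of_endCoinvariants_subsingleton D hγ] at hx
  exact (Submodule.mem_bot _).mp hx

/-- **Conversely: no nonzero finite `Λ`-submodule in `X^ε` and `(Sel^ε_∞)_γ` finite ⇒ `(Sel^ε_∞)_γ = 0`**: `X[T] ≅ Hom(S_γ, ℚ/ℤ)`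
is then finite, hence zero, and a finite group with trivial character group is trivial. [cite: GreenbergLNM1716, §4 p. 104] -/
theorem signed_endCoinvariants_subsingleton_of_forall_finite_eq_bot (D : SignedSelmerDualData W κ γ ε)
    (hγ : κ.IsTopGenerator γ) (hfin : Finite (EndCoinvariants (conjSignedSelmerInfty W κ ε γ - 1)))
    (hnf : ∀ N : Submodule (IwasawaAlgebra p) D.X, Finite N → N = ⊥) :
    Subsingleton (EndCoinvariants (conjSignedSelmerInfty W κ ε γ - 1)) := by
  obtain ⟨Φ, -⟩ := (D.isDualPair hγ).exists_invariants_addEquiv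
  haveI : Finite (invariants p D.X) := (PontryaginCard.finite_iff_of_addEquiv_characterModule Φ).mpr hfin
  have hbot : invariants p D.X = ⊥ := hnf _ inferInstance
  have h1 : Nat.card (EndCoinvariants (conjSignedSelmerInfty W κ ε γ - 1)) = 1 := by
    rw [← PontryaginCard.natCard_characterModule_of_finite, ← Nat.card_congr Φ.toEquiv, hbot]
    exact Nat.card_unique
  exact (Nat.card_eq_one_iff_unique.mp h1).1

/-- **COINV ⟺ no nonzero finite `Λ`-submodule** (under `(Sel^ε_∞)_γ` finite): `#(Sel^ε(E/K_∞))_γ = 1 ↔ ∀ N ≤ X^ε` finite,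
`N = 0` — for every number field, `ℤ_p`-extension, sign, topological generator and Pontryagin-dual datum.
[cite: GreenbergLNM1716, §4 p. 104] [cite: BDKim2013, Thm. 1.1 and Thm. 3.14] -/
theorem natCard_signedEndCoinvariants_eq_one_iff_forall_finite_eq_bot (D : SignedSelmerDualData W κ γ ε)
    (hγ : κ.IsTopGenerator γ) (hfin : Finite (EndCoinvariants (conjSignedSelmerInfty W κ ε γ - 1))) :
    Nat.card (EndCoinvariants (conjSignedSelmerInfty W κ ε γ - 1)) = 1 ↔
      ∀ N : Submodule (IwasawaAlgebra p) D.X, Finite N → N = ⊥ := by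
  constructor
  · intro h1
    haveI := (Nat.card_eq_one_iff_unique.mp h1).1
    exact signed_forall_finite_eq_bot_of_endCoinvariants_subsingleton D hγ
  · intro hnf
    haveI := signed_endCoinvariants_subsingleton_of_forall_finite_eq_bot D hγ hfin hnf
    exact Nat.card_unique

end NoFiniteSubmodule

/-! ## §3 `p = 2`: the registered stub `stub_plusCoinvTwo` from either printed reading -/

section Two

variable (W : WeierstrassCurve ℚ) (κ : ZpExtension ℚ 2) {γ : Field.absoluteGaloisGroup ℚ}

/-- **COINV⁺@2 from «`X⁺` has no nonzero finite `Λ₂`-submodule»** (B. D. Kim 2013 Thm. 1.1 READ AT `2`, as a statement about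
ONE Pontryagin-dual datum `D` of `Sel⁺(E/ℚ_∞)` — all data are isomorphic): for any `ℤ₂`-extension `κ` of `ℚ` with topological
generator `γ`, if `X⁺ = D.X` has no nonzero finite `Λ`-submodule then `(Sel⁺_∞)_γ` finite ⇒ `#(Sel⁺_∞)_γ = 1` — the body of the
registered stub `stub_plusCoinvTwo` (its habitat prefix and `Sel_{2^∞}(E/ℚ)`-finiteness premise are not needed for this step).
[cite: BDKim2013, Thm. 1.1 and Thm. 3.14] [cite: GreenbergLNM1716, §4 p. 104] -/
theorem plusCoinvTwo_of_forall_noFiniteSubmodule (hγ : κ.IsTopGenerator γ) (D : SignedSelmerDualData W κ γ 1)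
    (hnf : ∀ N : Submodule (IwasawaAlgebra 2) D.X, Finite N → N = ⊥)
    (hfin : Finite (EndCoinvariants (conjSignedSelmerInfty W κ 1 γ - 1))) :
    Nat.card (EndCoinvariants (conjSignedSelmerInfty W κ 1 γ - 1)) = 1 :=
  (natCard_signedEndCoinvariants_eq_one_iff_forall_finite_eq_bot D hγ hfin).mpr hnf

/-- **COINV⁺@2 from «DIV» ∧ «LIFT»** (Greenberg's Prop. 4.8 route for `Sel⁺` at `2`: «DIV» ⟸ Prop. 4.12 by name + the
`Λ`-corank-one count for `H¹(ℚ_Σ/ℚ_∞, E[2^∞])^∨`; «LIFT» ⟸ Cassels' theorem by name + local `Γ`-lifts at `Σ₀`, at `2`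
(`(E⁺_∞ ⊗ ℚ₂/ℤ₂)_Γ = 0`, the `±` local theory at `2`) and at `∞`), with no finiteness premise.
[cite: GreenbergLNM1716, §4 Lemma 4.7, Props. 4.8, 4.12, 4.13] -/
theorem plusCoinvTwo_of_div_of_lift (γ : Field.absoluteGaloisGroup ℚ)
    (hdiv : ∀ s : W.subgroupH1 2 κ.kerSubgroup, s ∈ signedSelmerInfty W κ 1 →
      ∃ t : W.subgroupH1 2 κ.kerSubgroup, W.conjH1 2 κ.kerSubgroup γ t - t = s)
    (hlift : ∀ t : W.subgroupH1 2 κ.kerSubgroup, W.conjH1 2 κ.kerSubgroup γ t - t ∈ signedSelmerInfty W κ 1 →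
      ∃ y : W.subgroupH1 2 (κ.layerSubgroup 0), t - W.layerToInfty κ 0 y ∈ signedSelmerInfty W κ 1) :
    Nat.card (EndCoinvariants (conjSignedSelmerInfty W κ 1 γ - 1)) = 1 :=
  natCard_signedEndCoinvariants_eq_one_of_div_of_lift W κ 1 γ hdiv hlift

/-- **The registered stub `stub_signedEulerCharTwo` from INJ⁺@2, Cassels' count and B. D. Kim's Thm. 1.1 READ AT `2`**
(«if `X⁺` is `Λ`-torsion it has no nonzero finite `Λ`-submodule», for every Pontryagin-dual datum — Kim's own packaging of
Cor. 3.15: Lemma 4.3-count × Thm. 3.14): for `W/ℚ` good supersingular at `2`, any `ℤ₂`-extension `κ` with topological generator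
`γ`, given INJ⁺@2, CASSELS⁺@0 in count form and KIM⁺@2, `Sel_{2^∞}(E/ℚ)` finite ⇒ `(Sel⁺_∞)^γ` finite and
`#(Sel⁺_∞)^γ = u · 2^{ord₂ ∏ c_ℓ} · #Sel_{2^∞}(E/ℚ) · #(Sel⁺_∞)_γ`. The torsion premise of KIM⁺ is discharged in the kernel: INJ⁺ ⇒
`ker g⁺` finite ⇒ `A⁺_0` finite ⇒ `(Sel⁺_∞)^γ` finite ⇒ `X⁺` torsion (`isTorsion_of_finite_endInvariants`).
[cite: BDKim2013, Thm. 1.1, Thm. 3.14 and Cor. 3.15] [cite: GreenbergLNM1716, §4 pp. 102–109] -/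
theorem signedEulerChar_two_of_localInj_of_cassels_of_kim [W.IsElliptic] [W.IsGloballyMinimal]
    (hss : Rank1Residual.GoodSS W 2) (hγ : κ.IsTopGenerator γ)
    (hinj : ∀ v : HeightOneSpectrum (𝓞 ℚ), (2 : 𝓞 ℚ) ∈ v.asIdeal →
      ∀ y ∈ (signedSelmerInfty W κ 1).comap (W.layerToInfty κ 0),
        W.localResOver 2 (κ.layerSubgroup 0) (v.adicCompletion ℚ) y = 0)
    (hCassels : Finite (W.selmerGroupPInfty 2) →
      Nat.card (↥((signedSelmerInfty W κ 1).comap (W.layerToInfty κ 0)) ⧸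
          (W.selmerLayer κ 0).addSubgroupOf ((signedSelmerInfty W κ 1).comap (W.layerToInfty κ 0))) =
        2 ^ padicValNat 2 W.tamagawaProduct)
    (hKim : ∀ (D : SignedSelmerDualData W κ γ 1) [Module.Finite (IwasawaAlgebra 2) D.X],
      Module.IsTorsion (IwasawaAlgebra 2) D.X → ∀ N : Submodule (IwasawaAlgebra 2) D.X, Finite N → N = ⊥)
    (hfin : Finite (W.selmerGroupPInfty 2)) :
    Finite (endInvariants (conjSignedSelmerInfty W κ 1 γ - 1)) ∧
      ∃ u : ℤ_[2]ˣ, (Nat.card (endInvariants (conjSignedSelmerInfty W κ 1 γ - 1)) : ℚ_[2]) =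
        ((u : ℤ_[2]) : ℚ_[2]) * ((2 : ℕ) : ℚ_[2]) ^ (padicValNat 2 W.tamagawaProduct) *
          (Nat.card (W.selmerGroupPInfty 2) : ℚ_[2]) *
            (Nat.card (EndCoinvariants (conjSignedSelmerInfty W κ 1 γ - 1)) : ℚ_[2]) := by
  -- INJ⁺ ⇒ `(Sel⁺_∞)^γ` finite ⇒ `X⁺` torsion, for the canonical datum
  have hkerg := finite_signedKerG_of_localResOver_eq_zero W κ 1 hinj
  have hA := finite_comap_layerToInfty_signedSelmerInfty_of_finite W κ 1 hfin hkerg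
  have hfinΓ : Finite ↥(endInvariants (conjSignedSelmerInfty W κ 1 γ - 1)) :=
    finite_endInvariants_conjSignedSelmerInfty_of_finite_comap W κ 1 hγ hA
  let D : SignedSelmerDualData W κ γ 1 := signedSelmerDualData W κ 1 hγ
  haveI := D.moduleFinite hγ
  have htor : Module.IsTorsion (IwasawaAlgebra 2) D.X := D.isTorsion_of_finite_endInvariants hγ hfinΓ
  exact signedEulerChar_two_of_localInj_of_cassels_of_coinv W hss κ hγ hinj hCassels
    (fun _ hco ↦ plusCoinvTwo_of_forall_noFiniteSubmodule W κ hγ D (hKim D htor) hco) hfin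

end Two

end Summit.BirchSwinnertonDyer.BirchSwinnertonDyer.Theorems.SignedEC

end
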